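import Literature.AlgebraicGeometry.HodgeTheory.FermatHodgeClassesLiftToCurvePowersSum
import Literature.AlgebraicGeometry.HodgeTheory.HodgeClassLiftRationalHodgeMaps
import Literature.AlgebraicGeometry.HodgeTheory.FermatJuxtapositionGysin
import Literature.AlgebraicGeometry.HodgeTheory.LefschetzOneOne
import Literature.AlgebraicGeometry.HodgeTheory.HodgeTypeConjugation
import Literature.AlgebraicGeometry.HodgeTheory.HypersurfaceLefschetzUpper
import Literature.AlgebraicGeometry.HodgeTheory.GysinFormalismHodgeOfGysin
import Literature.AlgebraicGeometry.HodgeTheory.HolomorphicBundleChernCharacterTopDegree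
import Literature.AlgebraicGeometry.HodgeTheory.RationalLattice
import Literature.AlgebraicGeometry.HodgeTheory.RationalClassesRingChange
import Literature.AlgebraicTopology.SingularHomology.CohomologyOfPoint
import HarnessLib

/-!
# `FermatHodgeClassesLiftToCurvePowersSum` off the middle degree: point hosts

Topic `Literature/AlgebraicGeometry/HodgeTheory`. Companion (theorems only, sorry-free; no definition
and no named fact is introduced, D-0026) of `FermatHodgeClassesLiftToCurvePowersSum.lean`, whose
named fact (Shioda–Katsura, *On Fermat varieties*, Tôhoku Math. J. 31 (1979), §1 Thm. 1.7,
Cor. 1.11, §2 Lemma 2.1, Prop. 2.4; Shioda, Math. Ann. 245 (1979), Thm. I) says: for `m, n ≥ 1` and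
every `p`, the rational `(p, p)`-classes of the Fermat variety `Xⁿₘ = fermatHypersurface n m` are
finite sums `Σᵢ Fᵢ aᵢ` of images, under `ℂ`-linear maps `Fᵢ : H^{2qᵢ}(C_m^{kᵢ}(ℂ); ℂ) → H²ᵖ(Xⁿₘ(ℂ); ℂ)`
carrying algebraic classes to algebraic classes, of rational `(qᵢ, qᵢ)`-classes `aᵢ` on cartesian
powers `C_m^{kᵢ} = (fermatHypersurface 1 m).pow kᵢ` of the Fermat curve.

The docstring of the fact records that OFF THE MIDDLE DEGREE the statement needs no
correspondence at all: "`2p ≠ n`: `H²ᵖ(Xⁿₘ, ℚ) = ℚ hᵖ`, one point host; `2p > 2n`: no hosts" —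
every class of `H²ᵖ(Xⁿₘ(ℂ); ℂ)`, `2p ≠ n`, is algebraic (Lefschetz's theorem on hyperplane sections
for the smooth hypersurface `Xⁿₘ ⊂ ℙⁿ⁺¹`, Voisin II Cor. 1.24–1.25 — the tree's THEOREM
`Voisin2003_smoothHypersurface_algebraicClasses_eq_top_holds` with `algebraicClasses_zero`,
`mem_algebraicClasses_of_degree_top`, `algebraicClasses_eq_top_of_lt`), and an algebraic class `c`
is `F(1)` for the point host `C_m⁰ = Spec ℂ` (`Motives.SchemeOver.pow_zero`), `F : a ↦ φ(a) • c`
with `φ : H⁰(pt; ℂ) ≃ ℂ` the evaluation (`singularCohomologyZeroEquiv`), `1 ∈ H⁰(pt; ℂ)` being a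
rational class of type `(0, 0)` (`isRationalClass_one`, `isOfHodgeType_zero_zero_zero`). This file
proves exactly that, on the tree's real carriers:

* `exists_linearMap_apply_one_eq_one` — on a smooth projective `Y` (so `Y(ℂ)` is path connected)
  there is a `ℂ`-linear `φ : H⁰(Y(ℂ); ℂ) → ℂ` with `φ(1) = 1`.
* `exists_pointHosts_of_forall_mem_algebraicClasses` — **point hosts**: for ANY smooth projective
  `X` of dimension `n`, any `C` and any `p`, if every rational `(p, p)`-class of `H²ᵖ(X(ℂ); ℂ)` is
  algebraic, then the body of the fact holds for `X` with hosts among the `C.pow k` (all `k = 0`,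
  `q = 0`): the rational `(p, p)`-classes are the image of a subset `S` of the finite-dimensional
  `H²ᵖ(X(ℂ); ℚ)` (`finite_singularCohomology_rat_complexPoints`, `IsRationalClass.exists_ringChange_eq`),
  a finite `T ⊆ S` spans `span_ℚ S` (`exists_linearIndependent`, Noetherianity), and
  `c = Σ_{t ∈ T} r_t ι(t) = Σ_t F_t (r_t • 1)` with `F_t = φ(–) • ι(t)` (`ringChange_sum_smul`).
* `fermatHodgeClassesLiftSum_of_two_mul_ne` — **the body of the fact at every `(m, n, p)` with
  `m, n ≥ 1` and `2p ≠ n`**, unconditionally; `fermatHodgeClassesLiftSum_of_odd` (all `p`, `n` odd —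
  in particular for the Fermat curves `n = 1` themselves);
  `fermatHodgeClassesLiftSum_of_hodgeClasses_algebraic_fermat` — all degrees, the middle one
  included, for `m` prime or `1 < m ≤ 20`, granted the named fact `hodgeClasses_algebraic_fermat`
  (Shioda 1979 Thm. 1 / Ran 1980 Thm. 4.9), again by point hosts.
* `FermatHodgeClassesLiftToCurvePowersSum_of_middle` — **the fact reduced to its crux**, the middle
  degree `n = 2p` (`p ≥ 1`): Shioda–Katsura's inductive structure proper (the blow-up
  correspondence `Z_{r,s} → X^{r+s}ₘ` of degree `m`, `ψ_*ψ^* = m`, the blow-up formula, Künneth, and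
  the lifting of Hodge classes along the resulting surjection from the polarised direct sum of the
  hosts' cohomology, Voisin 2025 Cor. 2.12), which is NOT proved here: the tree has neither the
  blow-up / `ℙ¹`-bundle of joining lines as a smooth projective `ℂ`-scheme nor the degree formula
  `ψ_*ψ^* = deg ψ` on its real carriers (module docstring of `FermatJuxtapositionGysin`, "What is NOT
  here"); `FermatHodgeClassesLiftToCurvePowersSum_of_lefschetzOneOne_of_middle` — granted Lefschetz
  `(1,1)` (the named fact `lefschetzOneOne_rational`) the Fermat SURFACES `X²ₘ` need point hosts
  only, and the crux is `n = 2p ≥ 4`.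
* **The Hodge-theoretic step IS proved** (section `Family`): by
  `exists_isRationalClass_isOfHodgeType_eq_sum` (file `HodgeClassLiftRationalHodgeMaps`: Voisin 2025
  Cor. 2.12 for a finite family of rational Hodge-linear maps, unconditional since
  `smoothProjective_hodgeStructure_isPolarizable_holds`), the body of the fact for ANY smooth
  projective `X`, curve `C` and `p` follows from a finite family of `ℂ`-linear maps
  `Fᵢ : H^{2qᵢ}(C^{kᵢ}(ℂ); ℂ) → H²ᵖ(X(ℂ); ℂ)`, `qᵢ + eᵢ = p`, which carry algebraic classes to
  algebraic classes, rational classes to rational classes, classes of type `(a, b)` to classes of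
  type `(a + eᵢ, b + eᵢ)`, and whose images jointly contain the rational `(p, p)`-classes
  (`curvePowersHodgeClassesLiftSum_of_family`) — in particular from a finite family of SPANS
  `C^{kᵢ} ←πᵢ— Eᵢ —φᵢ→ X` of smooth projective varieties with flat `πᵢ` whose composites
  `φᵢ_* ∘ πᵢ^*` jointly reach the rational `(p, p)`-classes (`curvePowersHodgeClassesLiftSum_of_spans`:
  spans transport algebraic classes, `complexGysin_map_mem_algebraicClasses_of_flat`, and are
  rational Hodge-linear, `isRationalHodgeMap_complexGysin_comp_map`). Hence
  `FermatHodgeClassesLiftToCurvePowersSum_of_families` / `…_of_spans`: **the fact follows from the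
  existence, for each `m ≥ 1`, `p ≥ 1`, of Shioda–Katsura's dominating family of correspondences
  from the `C_m^{kᵢ}` onto `H²ᵖ(X²ᵖₘ)`** — Tôhoku Math. J. 31 (1979), §1 Thm. 1.7 (diagram (1.25):
  blow-up `β : Z → X^{r-1}ₘ × C_m` along `X^{r-2}ₘ × X⁰ₘ`, quotient by `μₘ`, blow-down onto `Xʳₘ`),
  §2 Lemma 2.1 (blow-up formula), Lemma 2.2 (`H(X/G) = H(X)^G`), Prop. 2.4 (2.5) and Cor. 2.5
  (2.9): `Hⁱ(Xʳₘ) ⊕ H^{i-2}(X^{r-2}ₘ)(-1) ⊕ ⊕ⱼ H^{i-2j}(X⁰ₘ)(-j) ≅ [Hⁱ(X^{r-1}ₘ × C_m)]^{μₘ} ⊕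
  H^{i-2}(X^{r-2}ₘ × X⁰ₘ)(-1)`, iterated on `r` as in §3 (p. 107–108) and Remark 2.11 — which is
  the geometric input the tree does not have (no blow-ups of smooth projective `ℂ`-schemes).

## References

* [ShiodaKatsura1979] T. Shioda, T. Katsura, On Fermat varieties, Tôhoku Math. J. 31 (1979)
  97–115 (text read, J-STAGE open copy): §1 Lemma 1.1–1.6, Thm. 1.7 (1.25), Remark 1.9, Cor. 1.11;
  §2 Lemma 2.1–2.3, Prop. 2.4 (2.5), Cor. 2.5 (2.9), Thm. 2.10, Remark 2.11; §3 p. 107–108.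
* [Shioda1979HodgeFermat] T. Shioda, The Hodge conjecture for Fermat varieties, Math. Ann. 245
  (1979) 175–184, Thm. I.
* [VoisinHodgeII2003] C. Voisin, Hodge Theory and Complex Algebraic Geometry II, §1.2.2 Thm. 1.23,
  Cor. 1.24, Cor. 1.25.
* [Voisin2025] C. Voisin, Hodge and generalized Hodge conjectures, coniveau and algebraic cycles,
  J. Open Math. Probl. 1 (2025), Prop. 2.11 and Cor. 2.12.
* [HatcherAT2002] A. Hatcher, Algebraic Topology, §3.1 p. 198–199 (change of coefficients; `H⁰`).
* [VoisinHodgeI2002] C. Voisin, Hodge Theory and Complex Algebraic Geometry I, §7.1.1, §11.3.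
* [Shioda1979PJA] T. Shioda, The Hodge conjecture and the Tate conjecture for Fermat varieties,
  Proc. Japan Acad. 55A (1979) 111–114, §2 Thm. 1.  * [Ran1980] Z. Ran, Cycles on Fermat
  hypersurfaces, Compositio Math. 42 (1980) 121–142, Thm. 4.9.
-/

noncomputable section

open CategoryTheory AlgebraicGeometry
open Literature.AlgebraicTopology.SingularHomology
open Literature.AlgebraicGeometry.Motives

namespace Literature.AlgebraicGeometry.HodgeTheory

/-! ### Point hosts: the body of the fact wherever all rational `(p,p)`-classes are algebraic -/

section PointHosts

variable {n : ℕ} {X : Motives.SchemeOver ℂ}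

/-- On a smooth projective `Y` — `Y(ℂ)` is path connected
(`pathConnectedSpace_complexPoints_of_isSmoothProjective`) — evaluation of `0`-cocycles at a point
is a `ℂ`-linear `φ : H⁰(Y(ℂ); ℂ) → ℂ` (`singularCohomologyZeroEquiv`, Hatcher §3.1 p. 199) with
`φ(1) = 1`, `1` the class of the constant cocycle. [cite: HatcherAT2002, §3.1 p. 199 and §3.2 p. 211] -/
theorem exists_linearMap_apply_one_eq_one {d : ℕ} {Y : Motives.SchemeOver ℂ}
    (hY : IsSmoothProjective d Y) :
    ∃ φ : complexBetti Y 0 →ₗ[ℂ] ℂ, φ (singularCohomology.one ℂ (Motives.ComplexPoints Y)) = 1 := by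
  haveI := pathConnectedSpace_complexPoints_of_isSmoothProjective hY
  refine ⟨(singularCohomologyZeroEquiv ℂ ℂ (Motives.ComplexPoints Y)).toLinearMap, ?_⟩
  change singularCohomologyZeroEquiv ℂ ℂ (Motives.ComplexPoints Y)
    (singularCohomology.one ℂ (Motives.ComplexPoints Y)) = 1
  rw [singularCohomology.one, singularCohomologyZeroEquiv_π,
    singularCochainComplex.cocyclesZeroEquiv_apply, singularCochainComplex.iCocycles_mk]
  rfl

/-- **Point hosts.** Let `X` be smooth projective of dimension `n` over `ℂ`, `C` any `ℂ`-scheme and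
`p` any codimension, and suppose every rational class of Hodge type `(p, p)` in `H²ᵖ(X(ℂ); ℂ)` is
algebraic. Then there are finitely many hosts among the cartesian powers `C.pow k` — all equal to
the point `C⁰ = Spec ℂ`, in degree `0` — and `ℂ`-linear maps `Fᵢ : H⁰(C⁰(ℂ); ℂ) → H²ᵖ(X(ℂ); ℂ)`
carrying algebraic classes to algebraic classes such that every rational `(p, p)`-class `c` of `X`
is `Σᵢ Fᵢ aᵢ` for rational `(0, 0)`-classes `aᵢ`: the rational `(p, p)`-classes are `ι(S)` for a
subset `S` of the finite-dimensional `H²ᵖ(X(ℂ); ℚ)` (`ι` the change of coefficients), a finite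
`T ⊆ S` has `span_ℚ T = span_ℚ S`, and for `c = ι(Σ_{t ∈ T} r_t t)` one takes `F_t a = φ(a) • ι(t)`
(`φ(1) = 1`, `exists_linearMap_apply_one_eq_one`) and `a_t = r_t • 1`, a rational class of type
`(0, 0)` (`H^{0,0} = H⁰`). This is the mechanism "`2p ≠ n`: one point host" / "`kᵢ = 0` is the point
`C_m⁰ = Spec ℂ` with its degree-`0` classes" of the docstring of
`FermatHodgeClassesLiftToCurvePowersSum`. [cite: VoisinHodgeI2002, §7.1.1 and §11.3]
[cite: HatcherAT2002, §3.1 p. 198–199] -/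
theorem exists_pointHosts_of_forall_mem_algebraicClasses (hX : IsSmoothProjective n X)
    (C : Motives.SchemeOver ℂ) (p : ℕ)
    (halg : ∀ c : complexBetti X (2 * p), IsRationalClass c → IsOfHodgeType n X (2 * p) p p c →
      c ∈ algebraicClasses X p) :
    ∃ (ι : Type) (_ : Fintype ι) (k q : ι → ℕ)
      (F : ∀ i, complexBetti (C.pow (k i)) (2 * q i) →ₗ[ℂ] complexBetti X (2 * p)),
      (∀ i, ∀ a ∈ algebraicClasses (C.pow (k i)) (q i), F i a ∈ algebraicClasses X p) ∧
      ∀ c : complexBetti X (2 * p), IsRationalClass c → IsOfHodgeType n X (2 * p) p p c →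
        ∃ a : ∀ i, complexBetti (C.pow (k i)) (2 * q i),
          (∀ i, IsRationalClass (a i) ∧
            IsOfHodgeType (k i) (C.pow (k i)) (2 * q i) (q i) (q i) (a i)) ∧
          c = ∑ i, F i (a i) := by
  classical
  -- the point host `C⁰ = Spec ℂ`: smooth projective of dimension `0`, a Hodge model, `φ(1) = 1`
  have h0 : IsSmoothProjective 0 (C.pow 0) := isSmoothProjective_unit_holds ℂ
  obtain ⟨M⟩ := (nonempty_hodgeModel_holds (n := 0) (X := C.pow 0)).nonempty h0
  obtain ⟨φ, hφ⟩ := exists_linearMap_apply_one_eq_one h0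
  -- the `ℚ`-form `H²ᵖ(X(ℂ); ℚ)`, finite-dimensional, and the change of coefficients `ι`
  haveI : Module.Finite ℚ (singularCohomology ℚ ℚ (Motives.ComplexPoints X) (2 * p)) :=
    finite_singularCohomology_rat_complexPoints hX (2 * p)
  set ιX := singularCohomology.ringChange (algebraMap ℚ ℂ) (Motives.ComplexPoints X) (2 * p)
    with hιX
  -- the rational classes whose image is of type `(p, p)`, and a finite spanning subset `T`
  set S : Set (singularCohomology ℚ ℚ (Motives.ComplexPoints X) (2 * p)) :=
    {x | IsOfHodgeType n X (2 * p) p p (ιX x)} with hS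
  obtain ⟨T, hTS, hTspan, hTli⟩ := exists_linearIndependent ℚ S
  have hTfin : T.Finite := hTli.set_finite_of_isNoetherian
  haveI : Fintype T := hTfin.fintype
  refine ⟨T, inferInstance, fun _ ↦ 0, fun _ ↦ 0, fun t ↦ φ.smulRight (ιX t.1),
    fun t a _ ↦ ?_, fun c hc hcH ↦ ?_⟩
  · -- `F_t a = φ(a) • ι(t)` is algebraic because `ι(t)`, a rational `(p, p)`-class, is
    rw [LinearMap.smulRight_apply]
    exact Submodule.smul_mem _ _ (halg _ (isRationalClass_ringChange _) (hTS t.2))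
  · obtain ⟨x, rfl⟩ := hc.exists_ringChange_eq
    have hxS : x ∈ S := hcH
    have hxT : x ∈ Submodule.span ℚ T := by rw [hTspan]; exact Submodule.subset_span hxS
    obtain ⟨f, hf⟩ := Submodule.mem_span_iff_of_fintype.1 hxT
    refine ⟨fun t ↦ ((f t : ℚ) : ℂ) • singularCohomology.one ℂ (Motives.ComplexPoints (C.pow 0)),
      fun t ↦ ⟨(isRationalClass_one _).smul (f t), isOfHodgeType_zero_zero_zero M _⟩, ?_⟩
    calc ιX x = ιX (∑ t : T, f t • (t : singularCohomology ℚ ℚ (Motives.ComplexPoints X) (2 * p))) := by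
          rw [hf]
      _ = ∑ t : T, ((f t : ℚ) : ℂ) • ιX t := ringChange_sum_smul _ _ _
      _ = ∑ t : T, (φ.smulRight (ιX t.1))
            (((f t : ℚ) : ℂ) • singularCohomology.one ℂ (Motives.ComplexPoints (C.pow 0))) := by
          refine Finset.sum_congr rfl fun t _ ↦ ?_
          rw [LinearMap.smulRight_apply, map_smul, hφ, smul_eq_mul, mul_one]

end PointHosts

/-! ### The body of the fact off the middle degree -/

section Fermat

/-- **`FermatHodgeClassesLiftToCurvePowersSum` at every `(m, n, p)` with `2p ≠ n`** (`m, n ≥ 1`),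
unconditionally: the Fermat variety `Xⁿₘ = V₊(Σ xᵢᵐ) ⊂ ℙⁿ⁺¹` is a smooth hypersurface of
dimension `n` (`isSmoothHypersurface_fermatHypersurface`), so for `2p ≠ n` every class of
`H²ᵖ(Xⁿₘ(ℂ); ℂ)` is algebraic — Lefschetz's theorem on hyperplane sections, Voisin II
Cor. 1.24–1.25, the tree's theorem `Voisin2003_smoothHypersurface_algebraicClasses_eq_top_holds`
assembled with the degrees `p = 0`, `p ≥ n` (`.mem_algebraicClasses`) — and point hosts suffice
(`exists_pointHosts_of_forall_mem_algebraicClasses`): "`2p ≠ n`: `H²ᵖ(Xⁿₘ, ℚ) = ℚ hᵖ`, one point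
host; `2p > 2n`: no hosts". [cite: VoisinHodgeII2003, §1.2.2 Thm. 1.23, Cor. 1.24 and Cor. 1.25]
[cite: ShiodaKatsura1979, §1 Thm. 1.7 and Cor. 1.11 (the case needing no correspondence)] -/
theorem fermatHodgeClassesLiftSum_of_two_mul_ne {m n : ℕ} (hm : 1 ≤ m) (hn : 1 ≤ n) (p : ℕ)
    (hp : 2 * p ≠ n) :
    ∃ (ι : Type) (_ : Fintype ι) (k q : ι → ℕ)
      (F : ∀ i, complexBetti ((fermatHypersurface 1 m).pow (k i)) (2 * q i) →ₗ[ℂ]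
        complexBetti (fermatHypersurface n m) (2 * p)),
      (∀ i, ∀ a ∈ algebraicClasses ((fermatHypersurface 1 m).pow (k i)) (q i),
          F i a ∈ algebraicClasses (fermatHypersurface n m) p) ∧
      ∀ c : complexBetti (fermatHypersurface n m) (2 * p), IsRationalClass c →
        IsOfHodgeType n (fermatHypersurface n m) (2 * p) p p c →
          ∃ a : ∀ i, complexBetti ((fermatHypersurface 1 m).pow (k i)) (2 * q i),
            (∀ i, IsRationalClass (a i) ∧
              IsOfHodgeType (k i) ((fermatHypersurface 1 m).pow (k i)) (2 * q i) (q i) (q i) (a i)) ∧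
            c = ∑ i, F i (a i) :=
  exists_pointHosts_of_forall_mem_algebraicClasses (isSmoothProjective_fermatHypersurface hn hm) _ p
    fun c _ _ ↦ Voisin2003_smoothHypersurface_algebraicClasses_eq_top_holds.mem_algebraicClasses
      (isSmoothHypersurface_fermatHypersurface hn hm) hp c

/-- **`FermatHodgeClassesLiftToCurvePowersSum` in every degree for `n` odd** (`m ≥ 1`) — in
particular for the Fermat curves `C_m = X¹ₘ` themselves: `2p ≠ n` for all `p`.
[cite: VoisinHodgeII2003, Cor. 1.24 and Cor. 1.25] [cite: ShiodaKatsura1979, §1 Cor. 1.11] -/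
theorem fermatHodgeClassesLiftSum_of_odd {m n : ℕ} (hm : 1 ≤ m) (hn : Odd n) (p : ℕ) :
    ∃ (ι : Type) (_ : Fintype ι) (k q : ι → ℕ)
      (F : ∀ i, complexBetti ((fermatHypersurface 1 m).pow (k i)) (2 * q i) →ₗ[ℂ]
        complexBetti (fermatHypersurface n m) (2 * p)),
      (∀ i, ∀ a ∈ algebraicClasses ((fermatHypersurface 1 m).pow (k i)) (q i),
          F i a ∈ algebraicClasses (fermatHypersurface n m) p) ∧
      ∀ c : complexBetti (fermatHypersurface n m) (2 * p), IsRationalClass c →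
        IsOfHodgeType n (fermatHypersurface n m) (2 * p) p p c →
          ∃ a : ∀ i, complexBetti ((fermatHypersurface 1 m).pow (k i)) (2 * q i),
            (∀ i, IsRationalClass (a i) ∧
              IsOfHodgeType (k i) ((fermatHypersurface 1 m).pow (k i)) (2 * q i) (q i) (q i) (a i)) ∧
            c = ∑ i, F i (a i) := by
  obtain ⟨r, rfl⟩ := hn
  exact fermatHodgeClassesLiftSum_of_two_mul_ne hm (by omega) p (by omega)

/-- **The body of the fact in EVERY degree for `m` prime or `1 < m ≤ 20`, granted the named fact
`hodgeClasses_algebraic_fermat`** (Shioda 1979 Thm. 1 / Ran 1980 Thm. 4.9: the Hodge conjecture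
for `Xⁿₘ` in these degrees): then every rational `(p, p)`-class of `Xⁿₘ` is algebraic
(`isFermatVariety_fermatHypersurface`, `isSmoothProjective_fermatHypersurface`) and point hosts
suffice (`exists_pointHosts_of_forall_mem_algebraicClasses`) — the middle degree included.
[cite: Shioda1979PJA, §2 Thm. 1 and the list after it (p. 112)] [cite: Ran1980, Thm. 4.9] -/
theorem fermatHodgeClassesLiftSum_of_hodgeClasses_algebraic_fermat (h : hodgeClasses_algebraic_fermat)
    {m n : ℕ} (hm : m.Prime ∨ (1 < m ∧ m ≤ 20)) (hn : 1 ≤ n) (p : ℕ) :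
    ∃ (ι : Type) (_ : Fintype ι) (k q : ι → ℕ)
      (F : ∀ i, complexBetti ((fermatHypersurface 1 m).pow (k i)) (2 * q i) →ₗ[ℂ]
        complexBetti (fermatHypersurface n m) (2 * p)),
      (∀ i, ∀ a ∈ algebraicClasses ((fermatHypersurface 1 m).pow (k i)) (q i),
          F i a ∈ algebraicClasses (fermatHypersurface n m) p) ∧
      ∀ c : complexBetti (fermatHypersurface n m) (2 * p), IsRationalClass c →
        IsOfHodgeType n (fermatHypersurface n m) (2 * p) p p c →
          ∃ a : ∀ i, complexBetti ((fermatHypersurface 1 m).pow (k i)) (2 * q i),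
            (∀ i, IsRationalClass (a i) ∧
              IsOfHodgeType (k i) ((fermatHypersurface 1 m).pow (k i)) (2 * q i) (q i) (q i) (a i)) ∧
            c = ∑ i, F i (a i) := by
  have hm1 : 1 ≤ m := by
    rcases hm with hpr | ⟨h1, -⟩
    · exact hpr.one_lt.le
    · exact h1.le
  exact exists_pointHosts_of_forall_mem_algebraicClasses (isSmoothProjective_fermatHypersurface hn hm1)
    _ p (h hm (isFermatVariety_fermatHypersurface hm1) (isSmoothProjective_fermatHypersurface hn hm1) p)

/-- **The fact reduced to its crux, the middle degree.** `FermatHodgeClassesLiftToCurvePowersSum`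
follows from its instances at `(m, 2p, p)`, `m ≥ 1`, `p ≥ 1` — the middle cohomology
`H²ᵖ(X²ᵖₘ)` of the even-dimensional Fermat varieties, where Shioda–Katsura's inductive structure
(the blow-up correspondence `Z_{r,s} → X^{r+s}ₘ` of degree `m`, §1 Thm. 1.7; `ψ_*ψ^* = m` and the
blow-up formula, §2 Lemma 2.1, Prop. 2.4; Shioda's Thm. I) and the lifting of Hodge classes along
the resulting surjection (Voisin 2025, Cor. 2.12) are genuinely needed; all other `(m, n, p)` are
`fermatHodgeClassesLiftSum_of_two_mul_ne`.
[cite: ShiodaKatsura1979, §1 Thm. 1.7 and Cor. 1.11; §2 Lemma 2.1 and Prop. 2.4 (2.5)]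
[cite: Shioda1979HodgeFermat, Thm. I] [cite: Voisin2025, Prop. 2.11 and Cor. 2.12] -/
theorem FermatHodgeClassesLiftToCurvePowersSum_of_middle
    (hmid : ∀ (m p : ℕ), 1 ≤ m → 1 ≤ p →
      ∃ (ι : Type) (_ : Fintype ι) (k q : ι → ℕ)
        (F : ∀ i, complexBetti ((fermatHypersurface 1 m).pow (k i)) (2 * q i) →ₗ[ℂ]
          complexBetti (fermatHypersurface (2 * p) m) (2 * p)),
        (∀ i, ∀ a ∈ algebraicClasses ((fermatHypersurface 1 m).pow (k i)) (q i),
            F i a ∈ algebraicClasses (fermatHypersurface (2 * p) m) p) ∧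
        ∀ c : complexBetti (fermatHypersurface (2 * p) m) (2 * p), IsRationalClass c →
          IsOfHodgeType (2 * p) (fermatHypersurface (2 * p) m) (2 * p) p p c →
            ∃ a : ∀ i, complexBetti ((fermatHypersurface 1 m).pow (k i)) (2 * q i),
              (∀ i, IsRationalClass (a i) ∧
                IsOfHodgeType (k i) ((fermatHypersurface 1 m).pow (k i)) (2 * q i) (q i) (q i)
                  (a i)) ∧
              c = ∑ i, F i (a i)) :
    FermatHodgeClassesLiftToCurvePowersSum := by
  intro m n p hm hn
  by_cases hp : 2 * p = n
  · subst hp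
    exact hmid m p hm (by omega)
  · exact fermatHodgeClassesLiftSum_of_two_mul_ne hm hn p hp

end Fermat

/-! ### The Hodge-theoretic step: the body of the fact from a dominating family of rational Hodge-linear maps -/

section Family

variable {n : ℕ} {X C : Motives.SchemeOver ℂ}

/-- **The body of the fact, for curve-power hosts, from a dominating family of rational Hodge-linear
maps carrying algebraic classes to algebraic classes.** Let `X` be smooth projective of dimension
`n`, `C` a smooth projective curve, `p : ℕ`, and `Fᵢ : H^{2qᵢ}(C^{kᵢ}(ℂ); ℂ) → H²ᵖ(X(ℂ); ℂ)`
(`i ∈ ι` finite, `qᵢ + eᵢ = p`) `ℂ`-linear maps which carry `algebraicClasses (C^{kᵢ}) qᵢ` into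
`algebraicClasses X p`, rational classes to rational classes, classes of Hodge type `(a, b)` to
classes of type `(a + eᵢ, b + eᵢ)`, and whose images jointly contain every rational class of type
`(p, p)` — in print: `Fᵢ = Γᵢ,* ⊗ ℂ` for Shioda–Katsura's algebraic correspondences `Γᵢ` from the
`C_m^{kᵢ}` (Fulton Ch. 16; a correspondence acts on cycle classes, Cor. 19.2, and is a morphism of
Hodge structures of bidegree `(eᵢ, eᵢ)` defined over `ℚ`, Voisin I §7.3.2) with
`H²ᵖ(Xⁿₘ, ℚ) = Σᵢ Γᵢ,* H^{2qᵢ}(C_m^{kᵢ}, ℚ)` (Tôhoku §2 Prop. 2.4, Cor. 2.5 iterated). Then every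
rational `(p, p)`-class `c` of `X` is `Σᵢ Fᵢ aᵢ` for RATIONAL classes `aᵢ` of type `(qᵢ, qᵢ)`:
"Hodge classes lift along the resulting surjection from the polarisable direct sum
`⊕ᵢ H^{2qᵢ}(C_m^{kᵢ}, ℚ)(qᵢ - p) ↠ H²ᵖ(Xⁿₘ, ℚ)` (Voisin 2025, Cor. 2.12 with Prop. 2.11)" — the
tree's theorem `exists_isRationalClass_isOfHodgeType_eq_sum` (Cor. 2.12 for a finite family of
rational Hodge-linear maps, unconditional: `smoothProjective_hodgeStructure_isPolarizable_holds`),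
the powers `C^{kᵢ}` being smooth projective of dimension `kᵢ` (`IsSmoothProjective.pow`).
[cite: Voisin2025, Prop. 2.11 and Cor. 2.12] [cite: ShiodaKatsura1979, §2 Prop. 2.4 (2.5), Cor. 2.5 (2.9) and Remark 2.11]
[cite: Fulton1998, Ch. 16 Def. 16.1.2 and §19.2 Cor. 19.2] -/
theorem curvePowersHodgeClassesLiftSum_of_family (hX : IsSmoothProjective n X)
    (hC : IsSmoothProjective 1 C) (p : ℕ) {ι : Type} [Fintype ι] (k q e : ι → ℕ)
    (he : ∀ i, q i + e i = p)
    (F : ∀ i, complexBetti (C.pow (k i)) (2 * q i) →ₗ[ℂ] complexBetti X (2 * p))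
    (hFalg : ∀ i, ∀ a ∈ algebraicClasses (C.pow (k i)) (q i), F i a ∈ algebraicClasses X p)
    (hFrat : ∀ i a, IsRationalClass a → IsRationalClass (F i a))
    (hFtyp : ∀ i ⦃a b : ℕ⦄ ⦃x : complexBetti (C.pow (k i)) (2 * q i)⦄, a + b = 2 * q i →
      IsOfHodgeType (k i) (C.pow (k i)) (2 * q i) a b x →
        IsOfHodgeType n X (2 * p) (a + e i) (b + e i) (F i x))
    (hFsurj : ∀ c : complexBetti X (2 * p), IsRationalClass c → IsOfHodgeType n X (2 * p) p p c →
      c ∈ ⨆ i, LinearMap.range (F i)) :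
    ∃ (ι : Type) (_ : Fintype ι) (k q : ι → ℕ)
      (F : ∀ i, complexBetti (C.pow (k i)) (2 * q i) →ₗ[ℂ] complexBetti X (2 * p)),
      (∀ i, ∀ a ∈ algebraicClasses (C.pow (k i)) (q i), F i a ∈ algebraicClasses X p) ∧
      ∀ c : complexBetti X (2 * p), IsRationalClass c → IsOfHodgeType n X (2 * p) p p c →
        ∃ a : ∀ i, complexBetti (C.pow (k i)) (2 * q i),
          (∀ i, IsRationalClass (a i) ∧
            IsOfHodgeType (k i) (C.pow (k i)) (2 * q i) (q i) (q i) (a i)) ∧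
          c = ∑ i, F i (a i) :=
  ⟨ι, inferInstance, k, q, F, hFalg, fun c hc hcH ↦
    exists_isRationalClass_isOfHodgeType_eq_sum hX (m := k) (d := q) (Y := fun i ↦ C.pow (k i))
      (fun i ↦ by simpa using hC.pow (k i)) p e he F hFrat hFtyp hc hcH (hFsurj c hc hcH)⟩

/-- **The body of the fact, for curve-power hosts, from a dominating family of SPANS** (the shape
of Shioda–Katsura's correspondences: `β`, `ψ = λ ∘ π̄` of the diagram (1.25) and the exceptional
`ℙ¹`-bundles, made into spans `C_m^{kᵢ} ←πᵢ— Eᵢ —φᵢ→ Xⁿₘ` after iteration and products). Let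
`C^{kᵢ} ←πᵢ— Eᵢ —φᵢ→ X` (`i ∈ ι` finite) be spans of smooth projective varieties, `dim Eᵢ + eᵢ = n`,
`qᵢ + eᵢ = p`, with FLAT `πᵢ`, whose composites `φᵢ_* ∘ πᵢ^* : H^{2qᵢ}(C^{kᵢ}(ℂ); ℂ) → H²ᵖ(X(ℂ); ℂ)`
(`complexGysin μ`, any orientation family `μ`) jointly reach every rational `(p, p)`-class of `X`.
Then the body of the fact holds for `(X, C, p)` with `Fᵢ = uᵢ • φᵢ_* ∘ πᵢ^*` (`uᵢ ≠ 0` the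
orientation scalar making it defined over `ℚ`): spans with flat left leg transport algebraic
classes (`complexGysin_map_mem_algebraicClasses_of_flat`: flat pull-back, Hartshorne III 9.5, and
proper push-forward of supports, Fulton App. B), and `φᵢ_* ∘ πᵢ^*` is a rational Hodge-linear map of
bidegree `(eᵢ, eᵢ)` (`isRationalHodgeMap_complexGysin_comp_map`, Voisin I §7.3.2); conclude by
`curvePowersHodgeClassesLiftSum_of_family`. [cite: ShiodaKatsura1979, §1 Thm. 1.7 (1.25) and §2 Prop. 2.4, Cor. 2.5]
[cite: Voisin2025, Cor. 2.12] [cite: VoisinHodgeI2002, §7.3.2] [cite: Hartshorne1977, III Prop. 9.5] -/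
theorem curvePowersHodgeClassesLiftSum_of_spans (μ : OrientationFamily) (hX : IsSmoothProjective n X)
    (hC : IsSmoothProjective 1 C) (p : ℕ) {ι : Type} [Fintype ι] (k q e d : ι → ℕ)
    (he : ∀ i, q i + e i = p) (hd : ∀ i, d i + e i = n)
    (E : ι → Motives.SchemeOver ℂ) (hE : ∀ i, IsSmoothProjective (d i) (E i))
    (π : ∀ i, E i ⟶ C.pow (k i)) [∀ i, Flat (π i).left] (φ : ∀ i, E i ⟶ X)
    (hsurj : ∀ c : complexBetti X (2 * p), IsRationalClass c → IsOfHodgeType n X (2 * p) p p c →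
      c ∈ ⨆ i, LinearMap.range (complexGysin μ (hE i) hX (φ i)
        (show 2 * q i + 2 * n = 2 * p + 2 * d i by have := he i; have := hd i; omega) ∘ₗ
          (complexBetti.map (π i) (2 * q i)).hom)) :
    ∃ (ι : Type) (_ : Fintype ι) (k q : ι → ℕ)
      (F : ∀ i, complexBetti (C.pow (k i)) (2 * q i) →ₗ[ℂ] complexBetti X (2 * p)),
      (∀ i, ∀ a ∈ algebraicClasses (C.pow (k i)) (q i), F i a ∈ algebraicClasses X p) ∧
      ∀ c : complexBetti X (2 * p), IsRationalClass c → IsOfHodgeType n X (2 * p) p p c →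
        ∃ a : ∀ i, complexBetti (C.pow (k i)) (2 * q i),
          (∀ i, IsRationalClass (a i) ∧
            IsOfHodgeType (k i) (C.pow (k i)) (2 * q i) (q i) (q i) (a i)) ∧
          c = ∑ i, F i (a i) := by
  have hCk : ∀ i, IsSmoothProjective (k i) (C.pow (k i)) := fun i ↦ by simpa using hC.pow (k i)
  -- the orientation scalars `uᵢ ≠ 0` and the Hodge-linearity of `φᵢ_* ∘ πᵢ^*`
  have key := fun i ↦ isRationalHodgeMap_complexGysin_comp_map μ
    (OrientationFamily.hasPoincareDuality μ) (hE i) (hCk i) hX (π i) (φ i)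
    (show 2 * q i + 2 * n = 2 * p + 2 * d i by have := he i; have := hd i; omega) (he i)
  choose u hu hrat htyp using key
  set G : ∀ i, complexBetti (C.pow (k i)) (2 * q i) →ₗ[ℂ] complexBetti X (2 * p) := fun i ↦
    complexGysin μ (hE i) hX (φ i)
        (show 2 * q i + 2 * n = 2 * p + 2 * d i by have := he i; have := hd i; omega) ∘ₗ
      (complexBetti.map (π i) (2 * q i)).hom with hG
  refine curvePowersHodgeClassesLiftSum_of_family hX hC p k q e he (fun i ↦ u i • G i)
    (fun i a ha ↦ ?_) (fun i a ha ↦ ?_) (fun i a b x hab hx ↦ ?_) (fun c hc hcH ↦ ?_)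
  · -- algebraic classes: flat pull-back then proper push-forward
    rw [LinearMap.smul_apply]
    exact Submodule.smul_mem _ _ (complexGysin_map_mem_algebraicClasses_of_flat μ (hE i) (hCk i) hX
      (π i) (φ i) (by have := he i; have := hd i; omega) ha)
  · rw [LinearMap.smul_apply]
    exact hrat i a ha
  · rw [LinearMap.smul_apply]
    exact (htyp i hab hx).smul (u i)
  · have hr : ∀ i, LinearMap.range (u i • G i) = LinearMap.range (G i) :=
      fun i ↦ LinearMap.range_smul _ _ (hu i)
    simp_rw [hr]
    exact hsurj c hc hcH

end Family

/-! ### The fact from Shioda–Katsura's dominating families -/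

section Assembly

/-- **`FermatHodgeClassesLiftToCurvePowersSum` granted Lefschetz `(1,1)`, reduced to `n = 2p ≥ 4`.**
For the Fermat SURFACES `X²ₘ` (all `m ≥ 1`) every rational `(1, 1)`-class is a divisor class
(Lefschetz's theorem on `(1,1)`-classes, the named fact `lefschetzOneOne_rational`; for `X²ₘ` the
`3(m-1)(m-2) + …` lines, Shioda–Katsura Thm. 2.6 / Aoki–Shioda), so point hosts suffice
(`exists_pointHosts_of_forall_mem_algebraicClasses`); all `2p ≠ n` are
`fermatHodgeClassesLiftSum_of_two_mul_ne`. What is left is the middle cohomology of `X²ᵖₘ`, `p ≥ 2`.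
[cite: VoisinHodgeI2002, Thm. 11.30 and §11.3.3] [cite: ShiodaKatsura1979, §2 Thm. 2.6 and Remark 2.11] -/
theorem FermatHodgeClassesLiftToCurvePowersSum_of_lefschetzOneOne_of_middle
    (hL : lefschetzOneOne_rational)
    (hmid : ∀ (m p : ℕ), 1 ≤ m → 2 ≤ p →
      ∃ (ι : Type) (_ : Fintype ι) (k q : ι → ℕ)
        (F : ∀ i, complexBetti ((fermatHypersurface 1 m).pow (k i)) (2 * q i) →ₗ[ℂ]
          complexBetti (fermatHypersurface (2 * p) m) (2 * p)),
        (∀ i, ∀ a ∈ algebraicClasses ((fermatHypersurface 1 m).pow (k i)) (q i),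
            F i a ∈ algebraicClasses (fermatHypersurface (2 * p) m) p) ∧
        ∀ c : complexBetti (fermatHypersurface (2 * p) m) (2 * p), IsRationalClass c →
          IsOfHodgeType (2 * p) (fermatHypersurface (2 * p) m) (2 * p) p p c →
            ∃ a : ∀ i, complexBetti ((fermatHypersurface 1 m).pow (k i)) (2 * q i),
              (∀ i, IsRationalClass (a i) ∧
                IsOfHodgeType (k i) ((fermatHypersurface 1 m).pow (k i)) (2 * q i) (q i) (q i)
                  (a i)) ∧
              c = ∑ i, F i (a i)) :
    FermatHodgeClassesLiftToCurvePowersSum := by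
  refine FermatHodgeClassesLiftToCurvePowersSum_of_middle fun m p hm hp ↦ ?_
  rcases Nat.lt_or_ge p 2 with h1 | h2
  · obtain rfl : p = 1 := by omega
    exact exists_pointHosts_of_forall_mem_algebraicClasses
      (isSmoothProjective_fermatHypersurface (by norm_num) hm) _ 1
      fun c hc hcH ↦ hL (isSmoothProjective_fermatHypersurface (by norm_num) hm) c hc hcH
  · exact hmid m p hm h2

/-- **`FermatHodgeClassesLiftToCurvePowersSum` from Shioda–Katsura's dominating families of
rational Hodge-linear maps.** If for every `m ≥ 1`, `p ≥ 1` there is a finite family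
`Fᵢ : H^{2qᵢ}(C_m^{kᵢ}(ℂ); ℂ) → H²ᵖ(X²ᵖₘ(ℂ); ℂ)`, `qᵢ + eᵢ = p`, of `ℂ`-linear maps carrying
algebraic classes to algebraic classes, rational classes to rational classes, type `(a, b)` to type
`(a + eᵢ, b + eᵢ)`, whose images jointly contain the rational `(p, p)`-classes of the Fermat variety
`X²ᵖₘ` — Shioda–Katsura, Tôhoku Math. J. 31 (1979): the algebraic correspondences of the diagram
(1.25) of Thm. 1.7 (blow-up of `X^{r-1}ₘ × C_m` along `X^{r-2}ₘ × X⁰ₘ`, `μₘ`-quotient, blow-down onto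
`Xʳₘ`) give `Hⁱ(Xʳₘ) ⊕ H^{i-2}(X^{r-2}ₘ)(-1) ⊕ ⊕ⱼ H^{i-2j}(X⁰ₘ)(-j) ≅ [Hⁱ(X^{r-1}ₘ × C_m)]^{μₘ} ⊕
H^{i-2}(X^{r-2}ₘ × X⁰ₘ)(-1)` (§2 Lemma 2.1–2.2, Prop. 2.4 (2.5), Cor. 2.5 (2.9)), whence by
induction on `r` (§3 p. 107–108; Remark 2.11) `H*(Xʳₘ)` is the sum of the images of
correspondences from the `C_m^{r'}`, `r' ≤ r` — then the fact holds: the middle degree by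
`curvePowersHodgeClassesLiftSum_of_family` (Voisin 2025 Cor. 2.12, proved), the rest by
`FermatHodgeClassesLiftToCurvePowersSum_of_middle`. This isolates exactly the geometric input the
tree lacks (blow-ups of smooth projective `ℂ`-schemes and the blow-up formula on `H*(–(ℂ); ℂ)`).
[cite: ShiodaKatsura1979, §1 Thm. 1.7 (1.25), Cor. 1.11; §2 Lemma 2.1, Lemma 2.2, Prop. 2.4 (2.5), Cor. 2.5 (2.9), Remark 2.11; §3 p. 107–108]
[cite: Voisin2025, Prop. 2.11 and Cor. 2.12] [cite: Fulton1998, Ch. 16 Def. 16.1.2 and §19.2 Cor. 19.2] -/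
theorem FermatHodgeClassesLiftToCurvePowersSum_of_families
    (hfam : ∀ (m p : ℕ), 1 ≤ m → 1 ≤ p →
      ∃ (ι : Type) (_ : Fintype ι) (k q e : ι → ℕ)
        (F : ∀ i, complexBetti ((fermatHypersurface 1 m).pow (k i)) (2 * q i) →ₗ[ℂ]
          complexBetti (fermatHypersurface (2 * p) m) (2 * p)),
        (∀ i, q i + e i = p) ∧
        (∀ i, ∀ a ∈ algebraicClasses ((fermatHypersurface 1 m).pow (k i)) (q i),
            F i a ∈ algebraicClasses (fermatHypersurface (2 * p) m) p) ∧
        (∀ i a, IsRationalClass a → IsRationalClass (F i a)) ∧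
        (∀ i ⦃a b : ℕ⦄ ⦃x : complexBetti ((fermatHypersurface 1 m).pow (k i)) (2 * q i)⦄,
            a + b = 2 * q i →
            IsOfHodgeType (k i) ((fermatHypersurface 1 m).pow (k i)) (2 * q i) a b x →
              IsOfHodgeType (2 * p) (fermatHypersurface (2 * p) m) (2 * p) (a + e i) (b + e i)
                (F i x)) ∧
        ∀ c : complexBetti (fermatHypersurface (2 * p) m) (2 * p), IsRationalClass c →
          IsOfHodgeType (2 * p) (fermatHypersurface (2 * p) m) (2 * p) p p c →
            c ∈ ⨆ i, LinearMap.range (F i)) :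
    FermatHodgeClassesLiftToCurvePowersSum := by
  refine FermatHodgeClassesLiftToCurvePowersSum_of_middle fun m p hm hp ↦ ?_
  obtain ⟨ι, _, k, q, e, F, he, hFalg, hFrat, hFtyp, hFsurj⟩ := hfam m p hm hp
  exact curvePowersHodgeClassesLiftSum_of_family (isSmoothProjective_fermatHypersurface (by omega) hm)
    (isSmoothProjective_fermatHypersurface le_rfl hm) p k q e he F hFalg hFrat hFtyp hFsurj

/-- **`FermatHodgeClassesLiftToCurvePowersSum` from Shioda–Katsura's dominating families of
SPANS** — the purely geometric form of the remaining input: for every `m ≥ 1`, `p ≥ 1`, finitely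
many spans `C_m^{kᵢ} ←πᵢ— Eᵢ —φᵢ→ X²ᵖₘ` of smooth projective complex varieties with flat `πᵢ`,
`dim Eᵢ + eᵢ = 2p`, `qᵢ + eᵢ = p`, whose composites `φᵢ_* ∘ πᵢ^*` jointly reach every rational
`(p, p)`-class of `H²ᵖ(X²ᵖₘ(ℂ); ℂ)` (Shioda–Katsura's correspondences, Thm. 1.7 (1.25) with §2
Prop. 2.4, Cor. 2.5 iterated, reach ALL of `H²ᵖ`). Then the fact holds
(`curvePowersHodgeClassesLiftSum_of_spans`, `FermatHodgeClassesLiftToCurvePowersSum_of_middle`).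
[cite: ShiodaKatsura1979, §1 Thm. 1.7 (1.25), Cor. 1.11; §2 Prop. 2.4 (2.5), Cor. 2.5 (2.9), Remark 2.11]
[cite: Voisin2025, Cor. 2.12] -/
theorem FermatHodgeClassesLiftToCurvePowersSum_of_spans (μ : OrientationFamily)
    (hspan : ∀ (m p : ℕ) (hm : 1 ≤ m) (hp : 1 ≤ p),
      ∃ (ι : Type) (_ : Fintype ι) (k q e d : ι → ℕ) (he : ∀ i, q i + e i = p)
        (hd : ∀ i, d i + e i = 2 * p) (E : ι → Motives.SchemeOver ℂ)
        (hE : ∀ i, IsSmoothProjective (d i) (E i)) (π : ∀ i, E i ⟶ (fermatHypersurface 1 m).pow (k i))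
        (_ : ∀ i, Flat (π i).left) (φ : ∀ i, E i ⟶ fermatHypersurface (2 * p) m),
        ∀ c : complexBetti (fermatHypersurface (2 * p) m) (2 * p), IsRationalClass c →
          IsOfHodgeType (2 * p) (fermatHypersurface (2 * p) m) (2 * p) p p c →
            c ∈ ⨆ i, LinearMap.range
              (complexGysin μ (hE i) (isSmoothProjective_fermatHypersurface
                  (show 1 ≤ 2 * p by omega) hm) (φ i)
                  (show 2 * q i + 2 * (2 * p) = 2 * p + 2 * d i by
                    have := he i; have := hd i; omega) ∘ₗ
                (complexBetti.map (π i) (2 * q i)).hom)) :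
    FermatHodgeClassesLiftToCurvePowersSum := by
  refine FermatHodgeClassesLiftToCurvePowersSum_of_middle fun m p hm hp ↦ ?_
  obtain ⟨ι, _, k, q, e, d, he, hd, E, hE, π, hπ, φ, hsurj⟩ := hspan m p hm hp
  haveI := hπ
  exact curvePowersHodgeClassesLiftSum_of_spans μ (isSmoothProjective_fermatHypersurface (by omega) hm)
    (isSmoothProjective_fermatHypersurface le_rfl hm) p k q e d he hd E hE π φ hsurj

end Assembly

end Literature.AlgebraicGeometry.HodgeTheory

end
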